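import Mathlib
import HarnessLib
import Literature.Combinatorics.Additive.StepBeyondKempermanComplementProgressions

/-!
# Grynkiewicz 2009, §6 CASE I: the standing assumptions (47), (48), (49)

[cite: Grynkiewicz2009, §6 displays (47)–(49) (proof of Thm 4.1)] [tag: critical-pair] [tag: inverse-theorem]

Topic `Literature/Combinatorics/Additive`.  Cell `mm-stpp` (D-0046), seat `mm-stpp-lit` (gen 23); the
port of D. J. Grynkiewicz, *A step beyond Kemperman's structure theorem*, Mathematika **55** (2009)
67–114 continued.  §6, CASE I (print p. 27; overlines restored from arXiv:0710.1041v2 p. 24): «In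
view of Lemma 5.7 — which we can apply to `(A, B)` in view of Claims 3, 4, 5 and 6 — it follows that we
can assume (47) `d⊆(A, 𝒬𝒫), d⊆(B, 𝒬𝒫) ≥ 2`, else the proof is complete.  In view of Lemma 5.6 — which we
can apply to `(A, B)` in view of Claims 3, 4 and 5 — it follows that we can assume (48)
`d⊆(B̄, 𝒫), d⊆(Ā, 𝒫) ≥ 3`, else the proof is complete, whence in view of Lemma 5.7 — which we can apply
to `(−B, −γ + \overline{A + B})`, where `γ ∈ \overline{A + B}`, in view of Proposition 2.4, Claims 3, 5
and 6, (45), (46) and (48) — it follows that we can assume (49) `d⊆(\overline{A + B}, 𝒬𝒫) ≥ 2`, else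
`d⊆(−B, 𝒬𝒫) = d⊆(B, 𝒬𝒫) = 1`, a contradiction to (47).»

Lemma 5.7 is the tree's `subsetDist_eq_one_and_seventeen_of_subsetDist_eq_one`
(`NearlyQuasiPeriodicSummands.lean`), Lemma 5.6 is `seventeen_of_nearly_periodic`
(`NearlyPeriodicSummands.lean`), Lemma 5.4 is `not_isQuasiPeriodic_add_and_compl`, Proposition 2.4 is
`isNonExtendible_pair_neg_compl'`; the translation / negation invariance of `d⊆(·, 𝒬𝒫)` is
`subsetDist_vadd_eq` / `subsetDist_neg_eq` (`StepBeyondKempermanComplementProgressions.lean`).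

MAIN RESULTS (0 definitions, 0 named facts; everything PROVED), under the core-case standing
assumptions of Claims 1–4 (`G` finite, `0 ∈ A ∩ B`, `|A|, |B| ≥ 3`, `|A + B| = |A| + |B|`,
`d⊆(A + B, 𝒫) ≥ 3`, `(A, B)` non-extendible, `⟨A⟩ = ⟨B⟩ = G`, `A`, `B` not quasi-periodic) and Claim 6
(`max{|A|, |B|} ≥ 4`):
* `Grynkiewicz2009.two_le_subsetDist_isQuasiPeriodic_or_seventeen` — (47): `d⊆(A, 𝒬𝒫) ≥ 2` and
  `d⊆(B, 𝒬𝒫) ≥ 2`, or (17).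
* `Grynkiewicz2009.three_le_card_sdiff_compl_or_seventeen` — (48) for `Ā`: every periodic superset of
  `Ā` has at least three more elements, or (17) (Lemma 5.6 for `A = Pᶜ ∪ (A ∩ P)`); the version for
  `B̄` by symmetry, `three_le_card_sdiff_compl_or_seventeen_right`.
* `Grynkiewicz2009.two_le_subsetDist_compl_isQuasiPeriodic` — (49): given (47) for `B`, (48) for `Ā`
  and `|B| ≥ 4`, `d⊆(\overline{A + B}, 𝒬𝒫) ≥ 2` (Lemma 5.7 for `(−γ + \overline{A + B}, −B)`).

## References
* D. J. Grynkiewicz, *A step beyond Kemperman's structure theorem*, Mathematika 55 (2009) 67–114,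
  doi:10.1112/S0025579300000966, §6 (p. 27, displays (45)–(49)), Lemmas 5.4, 5.6, 5.7, Prop 2.4
  [cite: Grynkiewicz2009, Thm 4.1 (proof, displays (47)–(49))] — held
  `paper:doi-10-1112-s0025579300000966` p0027 and `paper:arxiv-0710.1041` p0024, read 2026-08-29.
-/

namespace Literature.Combinatorics.Additive

open Finset
open scoped Pointwise

universe u

variable {G : Type u} [AddCommGroup G] [DecidableEq G]

namespace Grynkiewicz2009

/-- In `ℕ∞`: not `≥ 2` means `≤ 1`. [folklore] -/
private theorem le_one_of_not_two_le {x : ℕ∞} (h : ¬ 2 ≤ x) : x ≤ 1 := by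
  by_contra h1
  exact h (by
    have := Order.add_one_le_of_lt (not_le.1 h1)
    rwa [one_add_one_eq_two] at this)

/-! ### (47) -/

/-- **Display (47): `d⊆(A, 𝒬𝒫), d⊆(B, 𝒬𝒫) ≥ 2`, else the proof is complete** (Lemma 5.7 for `(A, B)`
and for `(B, A)`; the value `0` is excluded since `A`, `B` are not quasi-periodic).
[cite: Grynkiewicz2009, §6 display (47) (proof of Thm 4.1, p. 27)] -/
theorem two_le_subsetDist_isQuasiPeriodic_or_seventeen [Fintype G] {A B : Finset G}
    (hA3 : 3 ≤ #A) (hB3 : 3 ≤ #B) (h4 : 4 ≤ #A ∨ 4 ≤ #B)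
    (h0A : (0 : G) ∈ A) (h0B : (0 : G) ∈ B) (hAB : #(A + B) = #A + #B)
    (hP3 : ∀ P : Finset G, A + B ⊆ P → P.addStab ≠ {0} → 3 ≤ #(P \ (A + B)))
    (hneA : IsNonExtendible A B) (hneB : IsNonExtendible B A)
    (hgenA : AddSubgroup.closure (A : Set G) = ⊤) (hgenB : AddSubgroup.closure (B : Set G) = ⊤)
    (hAqp : ¬ IsQuasiPeriodic A) (hBqp : ¬ IsQuasiPeriodic B) :
    (2 ≤ subsetDist A {P | IsQuasiPeriodic P} ∧ 2 ≤ subsetDist B {P | IsQuasiPeriodic P}) ∨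
      ∃ α β : G, #(insert α A + insert β B) + 1 = #(insert α A) + #(insert β B) := by
  classical
  have hBA : #(B + A) = #B + #A := by rw [add_comm, hAB, add_comm]
  have hP3' : ∀ P : Finset G, B + A ⊆ P → P.addStab ≠ {0} → 3 ≤ #(P \ (B + A)) := by
    rw [add_comm]; exact hP3
  by_cases hA2 : 2 ≤ subsetDist A {P | IsQuasiPeriodic P}
  · by_cases hB2 : 2 ≤ subsetDist B {P | IsQuasiPeriodic P}
    · exact Or.inl ⟨hA2, hB2⟩
    · right
      have hle := le_one_of_not_two_le hB2
      rcases eq_or_lt_of_le hle with h1 | h0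
      · exact seventeen_symm (subsetDist_eq_one_and_seventeen_of_subsetDist_eq_one hB3 hA3 h4.symm
          h0B h0A hBA hP3' hneB hneA hgenB h1).2
      · exact absurd (subsetDist_eq_zero_iff.1 (Order.lt_one_iff.1 h0)) hBqp
  · right
    have hle := le_one_of_not_two_le hA2
    rcases eq_or_lt_of_le hle with h1 | h0
    · exact (subsetDist_eq_one_and_seventeen_of_subsetDist_eq_one hA3 hB3 h4 h0A h0B hAB hP3 hneA
        hneB hgenA h1).2
    · exact absurd (subsetDist_eq_zero_iff.1 (Order.lt_one_iff.1 h0)) hAqp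

/-! ### (48) -/

/-- **Display (48) for `Ā`: `d⊆(Ā, 𝒫) ≥ 3`, else the proof is complete.**  If some periodic `P ⊇ Ā` has
`|P ∖ Ā| ≤ 2`, then `A = Pᶜ ∪ (A ∩ P)` with `Pᶜ ≠ ∅` periodic, with maximal period `H = H(Pᶜ) ≠ 0`, and
`|A ∩ P| ≤ 2` — at most two further elements, each inside an `H`-coset —, so Lemma 5.6
(`seventeen_of_nearly_periodic`) gives (17) (and `A ∩ P = ∅` would make `A` periodic).
[cite: Grynkiewicz2009, §6 display (48) (proof of Thm 4.1, p. 27); Lemma 5.6] -/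
theorem three_le_card_sdiff_compl_or_seventeen [Fintype G] {A B : Finset G}
    (hA3 : 3 ≤ #A) (hB3 : 3 ≤ #B) (h0A : (0 : G) ∈ A) (h0B : (0 : G) ∈ B)
    (hAB : #(A + B) = #A + #B)
    (hP3 : ∀ P : Finset G, A + B ⊆ P → P.addStab ≠ {0} → 3 ≤ #(P \ (A + B)))
    (hneA : IsNonExtendible A B) (hneB : IsNonExtendible B A)
    (hgen : AddSubgroup.closure (A : Set G) = ⊤) (hAqp : ¬ IsQuasiPeriodic A) :
    (∀ P : Finset G, Aᶜ ⊆ P → P.addStab ≠ {0} → 3 ≤ #(P \ Aᶜ)) ∨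
      ∃ α β : G, #(insert α A + insert β B) + 1 = #(insert α A) + #(insert β B) := by
  classical
  rw [or_iff_not_imp_left]
  intro h
  push Not at h
  obtain ⟨P, hAP, hPper, hlt⟩ := h
  -- `A' = Pᶜ ⊆ A` is nonempty and periodic; `S = A ∩ P` has at most two elements
  set A' : Finset G := Pᶜ with hA'
  set S : Finset G := P ∩ A with hSdef
  have hS : P \ Aᶜ = S := by
    ext x; simp only [mem_sdiff, mem_compl, not_not, hSdef, mem_inter]
  rw [hS] at hlt
  have hAeq : A = A' ∪ S := by
    ext x
    simp only [hA', hSdef, mem_union, mem_compl, mem_inter]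
    constructor
    · intro hx
      by_cases hxP : x ∈ P
      · exact Or.inr ⟨hxP, hx⟩
      · exact Or.inl hxP
    · rintro (hx | hx)
      · by_contra hxA
        exact hx (hAP (mem_compl.2 hxA))
      · exact hx.2
  have hA'ne : A'.Nonempty := by
    rw [nonempty_iff_ne_empty]
    intro h0
    rw [h0, empty_union] at hAeq
    have : #A ≤ 2 := by rw [hAeq]; omega
    omega
  have hdisj : Disjoint A' S := by
    rw [hA', hSdef, disjoint_left]
    intro x hx hxS
    exact (mem_compl.1 hx) (mem_inter.1 hxS).1
  -- the maximal period `H = H(A')` is nontrivial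
  let H : AddSubgroup G := AddAction.stabilizer G A'
  have hmemH : ∀ g, g ∈ H ↔ g +ᵥ A' = A' := fun g => AddAction.mem_stabilizer_iff
  have hA'H : ∀ g, g ∈ A'.addStab ↔ g ∈ H := fun g => by rw [mem_addStab hA'ne, hmemH]
  have hA'stab : A'.addStab ≠ {0} := by
    rcases P.eq_empty_or_nonempty with hP0 | hPne
    · -- `P = ∅`: `A' = G`, and `G` is nontrivial
      intro h1
      have huniv : A' = univ := by rw [hA', hP0, compl_empty]
      obtain ⟨x, hx, y, hy, hxy⟩ := one_lt_card.1 (by omega : 1 < #A)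
      have hmem : x - y ∈ A'.addStab := by
        rw [mem_addStab hA'ne, huniv]; exact vadd_finset_univ
      rw [h1, mem_singleton, sub_eq_zero] at hmem
      exact hxy hmem
    · rw [hA', addStab_compl hPne (by rw [← hA']; exact hA'ne)]
      exact hPper
  have hH : H ≠ ⊥ := by
    intro hbot
    apply hA'stab
    refine eq_singleton_iff_unique_mem.2 ⟨(hA'H 0).2 H.zero_mem, fun g hg => ?_⟩
    have := (hA'H g).1 hg
    rw [hbot, AddSubgroup.mem_bot] at this
    exact this
  -- split `S` into at most two singletons and apply Lemma 5.6
  have hcases : #S = 0 ∨ #S = 1 ∨ #S = 2 := by omega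
  rcases hcases with hS0 | hS1 | hS2
  · -- `A = A'` is periodic, hence quasi-periodic: impossible
    exfalso
    rw [card_eq_zero] at hS0
    rw [hS0, union_empty] at hAeq
    apply hAqp
    rw [hAeq]
    exact IsPeriodicWith.isQuasiPeriodic (fun g hg => (hmemH g).1 hg) hA'ne hH
  · obtain ⟨a₁, hSa⟩ := card_eq_one.1 hS1
    have hA : A = A' ∪ {a₁} ∪ ∅ := by rw [union_empty, hAeq, hSa]
    exact seventeen_of_nearly_periodic (a₁ := a₁) (a₂ := 0) hA hA'ne hH hA'H
      (fun x hx => by rw [mem_singleton] at hx; rw [hx, sub_self]; exact H.zero_mem)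
      (fun x hx => absurd hx (notMem_empty x)) hA3 hB3 h0A h0B hAB hP3 hneA hneB hgen hAqp
  · obtain ⟨a₁, a₂, -, hSa⟩ := card_eq_two.1 hS2
    have hA : A = A' ∪ {a₁} ∪ {a₂} := by rw [hAeq, hSa, union_assoc, ← insert_eq]
    exact seventeen_of_nearly_periodic (a₁ := a₁) (a₂ := a₂) hA hA'ne hH hA'H
      (fun x hx => by rw [mem_singleton] at hx; rw [hx, sub_self]; exact H.zero_mem)
      (fun x hx => by rw [mem_singleton] at hx; rw [hx, sub_self]; exact H.zero_mem)
      hA3 hB3 h0A h0B hAB hP3 hneA hneB hgen hAqp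

/-- **Display (48) for `B̄`** (by symmetry, with `⟨B⟩ = G` and `B` not quasi-periodic).
[cite: Grynkiewicz2009, §6 display (48) (proof of Thm 4.1, p. 27); Lemma 5.6] -/
theorem three_le_card_sdiff_compl_or_seventeen_right [Fintype G] {A B : Finset G}
    (hA3 : 3 ≤ #A) (hB3 : 3 ≤ #B) (h0A : (0 : G) ∈ A) (h0B : (0 : G) ∈ B)
    (hAB : #(A + B) = #A + #B)
    (hP3 : ∀ P : Finset G, A + B ⊆ P → P.addStab ≠ {0} → 3 ≤ #(P \ (A + B)))
    (hneA : IsNonExtendible A B) (hneB : IsNonExtendible B A)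
    (hgenB : AddSubgroup.closure (B : Set G) = ⊤) (hBqp : ¬ IsQuasiPeriodic B) :
    (∀ P : Finset G, Bᶜ ⊆ P → P.addStab ≠ {0} → 3 ≤ #(P \ Bᶜ)) ∨
      ∃ α β : G, #(insert α A + insert β B) + 1 = #(insert α A) + #(insert β B) := by
  have hBA : #(B + A) = #B + #A := by rw [add_comm, hAB, add_comm]
  have hP3' : ∀ P : Finset G, B + A ⊆ P → P.addStab ≠ {0} → 3 ≤ #(P \ (B + A)) := by
    rw [add_comm]; exact hP3
  rcases three_le_card_sdiff_compl_or_seventeen hB3 hA3 h0B h0A hBA hP3' hneB hneA hgenB hBqp with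
    h | h
  · exact Or.inl h
  · exact Or.inr (seventeen_symm h)

/-! ### (49) -/

/-- **Display (49): `d⊆(\overline{A + B}, 𝒬𝒫) ≥ 2`.**  Given (47) for `B`, (48) for `Ā` and `|B| ≥ 4`
(Claim 6), under the core-case standing assumptions: Lemma 5.7 for the translated dual pair
`(−γ + \overline{A + B}, −B)` of Proposition 2.4 (sum `−γ + Ā`; `⟨−γ + \overline{A + B}⟩ = G` and
non-quasi-periodicity by Lemma 5.4) would otherwise give `d⊆(−B, 𝒬𝒫) = d⊆(B, 𝒬𝒫) = 1`.
[cite: Grynkiewicz2009, §6 display (49) (proof of Thm 4.1, p. 27); Lemma 5.7] -/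
theorem two_le_subsetDist_compl_isQuasiPeriodic [Fintype G] {A B : Finset G}
    (h0A : (0 : G) ∈ A) (h0B : (0 : G) ∈ B) (hA3 : 3 ≤ #A) (hB4 : 4 ≤ #B) (hC3 : 3 ≤ #(A + B)ᶜ)
    (hAB : #(A + B) = #A + #B) (haper : (A + B).addStab = {0})
    (h48 : ∀ P : Finset G, Aᶜ ⊆ P → P.addStab ≠ {0} → 3 ≤ #(P \ Aᶜ))
    (hneA : IsNonExtendible A B) (hneB : IsNonExtendible B A)
    (hgen : AddSubgroup.closure (A : Set G) = ⊤) (hAqp : ¬ IsQuasiPeriodic A)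
    (h47 : 2 ≤ subsetDist B {P | IsQuasiPeriodic P}) :
    2 ≤ subsetDist (A + B)ᶜ {P | IsQuasiPeriodic P} := by
  classical
  by_contra hlt
  have hle := le_one_of_not_two_le hlt
  obtain ⟨-, hCqp, hCgen⟩ :=
    not_isQuasiPeriodic_add_and_compl hA3 hC3 h0A h0B hAB haper hneA hneB hgen hAqp
  rcases eq_or_lt_of_le hle with h1 | h0
  swap
  · exact hCqp (subsetDist_eq_zero_iff.1 (Order.lt_one_iff.1 h0))
  -- the translated dual pair `(X, Y) = (−γ + (A + B)ᶜ, −B)`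
  have hAne : A.Nonempty := ⟨0, h0A⟩
  obtain ⟨γ, hγ⟩ : ((A + B)ᶜ).Nonempty := card_pos.1 (by omega)
  obtain ⟨hsum, hneX₀, hneY₀⟩ := isNonExtendible_pair_neg_compl' hneA hneB
  set X : Finset G := (-γ) +ᵥ (A + B)ᶜ with hX
  set Y : Finset G := -B with hY
  have hXY_eq : X + Y = (-γ) +ᵥ Aᶜ := by
    rw [hX, hY, vadd_add_assoc, add_comm ((A + B)ᶜ) (-B), hsum]
  have hXcard : #X = #(A + B)ᶜ := card_vadd_finset _ _
  have hYcard : #Y = #B := card_neg B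
  have hGcard : Fintype.card G = #A + #B + #(A + B)ᶜ := by
    have h1 := card_compl (A + B)
    have h2 := card_le_univ (A + B)
    omega
  have hAc : #Aᶜ = #B + #(A + B)ᶜ := by
    rw [card_compl, hGcard]; omega
  have hXY : #(X + Y) = #X + #Y := by rw [hXY_eq, card_vadd_finset, hAc, hXcard, hYcard, add_comm]
  have h0X : (0 : G) ∈ X := mem_vadd_finset.2 ⟨γ, hγ, by simp⟩
  have h0Y : (0 : G) ∈ Y := by rw [hY, mem_neg', neg_zero]; exact h0B
  have hX3 : 3 ≤ #X := by rw [hXcard]; exact hC3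
  have hY3 : 3 ≤ #Y := by rw [hYcard]; omega
  have hY4 : 4 ≤ #Y := by rw [hYcard]; exact hB4
  have hP3X : ∀ P : Finset G, X + Y ⊆ P → P.addStab ≠ {0} → 3 ≤ #(P \ (X + Y)) := by
    rw [hXY_eq]; exact forall_card_sdiff_vadd _ h48
  have hneX : IsNonExtendible X Y := hneY₀.vadd_left (-γ)
  have hneY : IsNonExtendible Y X := hneX₀.vadd_right (-γ)
  have hgenX : AddSubgroup.closure (X : Set G) = ⊤ := hCgen γ hγ
  have hdX : subsetDist X {P | IsQuasiPeriodic P} = 1 := by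
    rw [hX, subsetDist_vadd_eq (-γ) fun P => isQuasiPeriodic_vadd_iff (-γ)]; exact h1
  have hYQP : subsetDist Y {P | IsQuasiPeriodic P} = subsetDist B {P | IsQuasiPeriodic P} :=
    subsetDist_neg_eq fun P => isQuasiPeriodic_neg_iff
  have h57 := (subsetDist_eq_one_and_seventeen_of_subsetDist_eq_one hX3 hY3 (Or.inr hY4) h0X h0Y hXY
    hP3X hneX hneY hgenX hdX).1 Y (by simp)
  rw [hYQP] at h57
  rw [h57] at h47
  exact absurd h47 (by decide)

end Grynkiewicz2009

end Literature.Combinatorics.Additive
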